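import Literature.MathematicalPhysics.QuantumFieldTheory.U1DualRepresentation
import HarnessLib

/-!
# Reversal symmetry of rectangular Wilson loops

Support file of the proof programme of the named fact
`Literature.MathematicalPhysics.QuantumFieldTheory.FrohlichSpencerU1PerimeterLawD4`: the fact
quantifies over all pairs of distinct directions `i ≠ j`, while the flux/sheet representation
(`U1DualFluxEnsemble.zdExpect_u1_wilsonLoop_eq_closedFlux`, hypothesis `rectPlaqs ⊆ plaquettesIn Λ`)
is only available for `i < j` (Sweep1's `plaquettesIn` lists each plaquette once, with `i < j`).
The reduction of the case `i > j` to `i < j` is the elementary reversal symmetry proved here: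

* `ZdGaugeConfig.rectangle_swap` — traversing the `R × T` rectangle in the `(j, i)` order is the
  reversed loop, `U_{γ⁻¹} = U_γ⁻¹` (any group);
* `zdWilsonLoop_swap_of_unitary` — for a representation with unitary values,
  `W_γ = (1/N) Re tr ρ(U_γ)` is invariant under reversal (`tr ρ(g⁻¹) = conj tr ρ(g)`, as in
  `LatticeGaugeDobrushinPoincare.re_trace_map_inv`, copied privately here);
* `loopCurrent_swap : J_{γ⁻¹} = -J_γ` and `zdWilsonLoop_u1Rep_swap` — the `U(1)` case.

Everything is proved; no named fact is introduced.

## References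

* K. Osterwalder, E. Seiler, Ann. Phys. 110 (1978) 440–471, §2 (Wilson loops). [OsterwalderSeiler1978]
-/

noncomputable section

open Literature.Probability.LatticeModels Literature.MathematicalPhysics.QuantumLattice

namespace Literature.MathematicalPhysics.QuantumFieldTheory

open AreaLaw

variable {d : ℕ}

namespace ZdGaugeConfig

variable {G : Type*} [Group G]

/-- **Reversal of a rectangular loop**: the `T × R` rectangle in the `(j, i)` plane based at `x`
is the `R × T` rectangle in the `(i, j)` plane traversed backwards, so its holonomy is the
inverse. [folklore] -/
theorem rectangle_swap (U : ZdGaugeConfig d G) (x : Literature.Probability.LatticeModels.Site d)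
    (i j : Fin d) (R T : ℕ) :
    U.rectangle x j i T R = (U.rectangle x i j R T)⁻¹ := by
  simp only [rectangle, mul_inv_rev, inv_inv, mul_assoc]

end ZdGaugeConfig

section General

variable {N : ℕ} {G : Type*} [Group G] (ρ : G →* Matrix (Fin N) (Fin N) ℂ)

/-- For a representation with unitary values, `ρ(g⁻¹) = ρ(g)ᴴ` (local copy of
`LatticeGaugeDobrushinPoincare.map_inv_eq_conjTranspose`, to keep the import closure small). [folklore] -/
private theorem map_inv_eq_conjTranspose' (hρ : ∀ g, ρ g ∈ Matrix.unitaryGroup (Fin N) ℂ) (g : G) :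
    ρ g⁻¹ = (ρ g).conjTranspose := by
  have h2 : ρ g * star (ρ g) = 1 := Matrix.mem_unitaryGroup_iff.1 (hρ g)
  have h3 : ρ g⁻¹ * ρ g = 1 := by rw [← map_mul, inv_mul_cancel, map_one]
  -- both are two-sided inverses of `ρ g`
  calc ρ g⁻¹ = ρ g⁻¹ * (ρ g * star (ρ g)) := by rw [h2, mul_one]
    _ = (ρ g⁻¹ * ρ g) * star (ρ g) := by rw [mul_assoc]
    _ = star (ρ g) := by rw [h3, one_mul]
    _ = (ρ g).conjTranspose := rfl

/-- `Re tr ρ(g⁻¹) = Re tr ρ(g)` for unitary-valued `ρ` (local copy of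
`LatticeGaugeDobrushinPoincare.re_trace_map_inv`). [folklore] -/
private theorem re_trace_map_inv' (hρ : ∀ g, ρ g ∈ Matrix.unitaryGroup (Fin N) ℂ) (g : G) :
    (ρ g⁻¹).trace.re = (ρ g).trace.re := by
  rw [map_inv_eq_conjTranspose' ρ hρ, Matrix.trace_conjTranspose, Complex.star_def, Complex.conj_re]

/-- **Reversal symmetry of the Wilson loop observable** (unitary-valued `ρ`):
`W_{T×R}^{(j,i)}(x) = W_{R×T}^{(i,j)}(x)`. [cite: OsterwalderSeiler1978, §2] -/
theorem zdWilsonLoop_swap_of_unitary (hρ : ∀ g, ρ g ∈ Matrix.unitaryGroup (Fin N) ℂ)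
    (x : Literature.Probability.LatticeModels.Site d) (i j : Fin d) (R T : ℕ) :
    zdWilsonLoop ρ x j i T R = zdWilsonLoop ρ x i j R T := by
  funext U
  simp only [zdWilsonLoop, ZdGaugeConfig.rectangle_swap U x i j R T, re_trace_map_inv' ρ hρ]

end General

/-- **Reversal of the loop current**: `J_{γ⁻¹} = -J_γ`. [folklore] -/
theorem loopCurrent_swap (x : Literature.Probability.LatticeModels.Site d) (i j : Fin d) (R T : ℕ) :
    loopCurrent x j i T R = -loopCurrent x i j R T := by
  simp only [loopCurrent]
  abel

/-- **Reversal symmetry of the `U(1)` Wilson loop**: `zdWilsonLoop u1Rep x j i T R = zdWilsonLoop u1Rep x i j R T`.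
[cite: OsterwalderSeiler1978, §2] -/
theorem zdWilsonLoop_u1Rep_swap (x : Literature.Probability.LatticeModels.Site d) (i j : Fin d) (R T : ℕ) :
    zdWilsonLoop u1Rep x j i T R = zdWilsonLoop u1Rep x i j R T :=
  zdWilsonLoop_swap_of_unitary u1Rep u1Rep_mem_unitaryGroup x i j R T

/-- The same for expectations: `⟨W_{T×R}^{(j,i)}⟩_Λ = ⟨W_{R×T}^{(i,j)}⟩_Λ` (any `β`, `Λ`). [folklore] -/
theorem zdExpect_zdWilsonLoop_u1Rep_swap (β : ℝ) (Λ : Finset (Literature.Probability.LatticeModels.Site d))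
    (x : Literature.Probability.LatticeModels.Site d) (i j : Fin d) (R T : ℕ) :
    zdExpect u1Rep β Λ (zdWilsonLoop u1Rep x j i T R) = zdExpect u1Rep β Λ (zdWilsonLoop u1Rep x i j R T) := by
  rw [zdWilsonLoop_u1Rep_swap]

end Literature.MathematicalPhysics.QuantumFieldTheory
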